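import Literature.IUT.HodgeArakelov.RealifiedPrimeStripSplitRigidity

/-!
# [IUTchII] Def 4.9 (viii) / Cor 4.10 (iv)–(v): degree-classification is an ISOMORPHISM INVARIANT of print-level
# `F^{⊩▶×μ}`-prime-strips; on the connected component of a degree-classified model, passing to the
# `F^{⊢▶×μ}`-prime-strip is FAITHFUL (rigidity in the currency the strip frames consume)

Proof-only sequel (abc-iut cell, layer L6; abc-iut-L6-t22 gen 10; 0 definitions) of `RealifiedPrimeStripSplitRigidity.lean`
(rigidity / fullness of the global component of a morphism of `F^{⊩▶×μ}`-prime-strips at DEGREE-CLASSIFIED strips,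
disposition of D-L6t22-R9F1a ratified by L6-lead §F v1.19i (1)) in the currency of abc-iut-w5-d087's
`RealifiedPrimeStripSplitComponent.lean`: the connected full subgroupoid `KitComponent M = {S | Nonempty (S ≅ M)}` of a
model strip `M` — print's «collection of data … isomorphic to `‡𝔉`» ([IUTchII] Def 4.9 (vii)/(viii) p. 158; [IUTchI]
Def 5.2 (iv)(f) p. 135 «isomorphic to the collection of data `𝔉^⊩_mod`») as a TYPE, which is what a strip frame's
`Fglxm` is (abc-iut-L6-t3 `StripFrame.ofKits`, abc-iut-w4-d028 `TimesMuSide`). [cite: Mochizuki2012, Def 4.9 (viii) p.158]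
v2 (gen 16, DOC-ONLY; referee flag O12-F19 (a)(b)): the two «isomorphic to the category `𝒞^⊩_mod`» quotes below now carry
print's words «the category» ([IUTchI] p. 134 l. 57–59 → p. 135 l. 2) and the clause letter Def 5.2 (iv)(a) [(f) is the
collection-of-data clause quoted above]; all declarations byte-identical to v1.

WHAT IS PROVED (elementary; hypotheses BY NAME).
* `degClass_injective_iff_of_hom` / `degClass_bijective_iff_of_hom` — a morphism `S ⟶ T` of print-level strips carries a
  degree-matching bijection of isomorphism classes, so `S` is degree-classified (onto `ℝ`) iff `T` is: the MODEL
  CONDITION (c′) of R9-F1 is an isomorphism invariant, hence holds on the whole component of a model satisfying it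
  (`KitComponent.degClass_injective` / `_bijective`) — in print every `*𝒞^⊩` is «isomorphic to the category `𝒞^⊩_mod`»
  ([IUTchI] Def 5.2 (iv)(a) pp. 134–135), which IS degree-classified ([FrdI] Thm 6.4 (i) `δ_A : Pic_Φ(A) ⥲ ℝ`;
  genuine-model witness `LogThetaLattice/GlobalLGPFrobenioidsRealifiedDegClassified.lean`).
* **`KitComponent.faithful_toSplitStrip`** — on the component of a degree-classified model `M`, the composite
  `(kitProperty M).ι ⋙ toSplitStripFunctor : KitComponent M ⥤ FSplitTriMuPrimeStrip` («passing to the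
  `F^{⊢▶×μ}`-prime-strip») is FAITHFUL: `Aut_{F^{⊩▶×μ}}(S) ↪ Aut_{F^{⊢▶×μ}}(S)` and `Isom(S,T) ↪ Isom` for all members —
  the rigidity direction complementary to abc-iut-w4-d028's SURJECTIVITY onto `F^{⊢×μ}` (`mapAut_toTimesMu_surjective`,
  [IUTchIII] Thm 2.2 (i)) and to w5-d087's `KitComponent.mapIso_toTimesMu_surjective` ([IUTchII] Cor 4.10 (iv)); so the
  «larger automorphism groups» risk named in R9-F1 / O7-F1 is ABSENT on such components.
* `KitComponent.hom_bijective_local` — on the component of a model degree-classified ONTO `ℝ`, `Hom(A, B)` IS the set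
  of `V`-families of split local isomorphisms compatible with the `ρ_v` and the generators at bad places; and
  `KitComponent.iso_unique_of_locSplitIso` — the isomorphism `A ≅ B` (which exists on the component) with a prescribed
  local part is UNIQUE ([IUTchII] Cor 4.6 (ii) «uniquely determined by … local isomorphisms»).
HONEST FRAMING: bookkeeping over the cell's typed records; nothing here asserts a disputed claim or takes a side on
[IUTchIII] Cor 3.12; typed ≠ proved for every interface-level statement upstream.
-/

namespace Literature.IUT.HodgeArakelov

open CategoryTheory

universe u v w

namespace FVdashSplitTriMuPrimeStrip

variable {V : Type u} {P : PlaceData V} {G : V → Type u} [∀ v, Group (G v)]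
  {X : ∀ v, GroupTheoreticUnits.{u, w} (G v)} {S T : FVdashSplitTriMuPrimeStrip.{u, v, w} P G X}

/-! ### §1 Degree-classification is an isomorphism invariant -/

/-- Along a morphism of print-level strips the degree-on-classes of the source FACTORS through that of the target via
the class bijection: `degClass_S = degClass_T ∘ classEquiv`. (bookkeeping) [cite: Mochizuki2012, Def 4.9 (viii) p.158] -/
theorem degClass_comp_classEquiv (f : S ⟶ T) :
    T.data.realifiedF.degClass ∘ f.classEquiv = S.data.realifiedF.degClass :=
  funext f.degClass_eq

/-- **IUTchII:Def4.9(viii)** (kurims p.158) degree-classification (injective `degClass`) is an ISOMORPHISM INVARIANT of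
print-level `F^{⊩▶×μ}`-prime-strips. [cite: Mochizuki2012, Def 4.9 (viii) p.158] -/
theorem degClass_injective_iff_of_hom (f : S ⟶ T) :
    Function.Injective S.data.realifiedF.degClass ↔ Function.Injective T.data.realifiedF.degClass := by
  rw [← degClass_comp_classEquiv f]
  constructor
  · intro h
    exact Function.Injective.of_comp_right h f.classEquiv.surjective
  · intro h
    exact h.comp f.classEquiv.injective

/-- **IUTchII:Def4.9(viii)** (kurims p.158) degree-classification ONTO `ℝ` (bijective `degClass`) is an isomorphism
invariant of print-level `F^{⊩▶×μ}`-prime-strips. [cite: Mochizuki2012, Def 4.9 (viii) p.158] -/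
theorem degClass_bijective_iff_of_hom (f : S ⟶ T) :
    Function.Bijective S.data.realifiedF.degClass ↔ Function.Bijective T.data.realifiedF.degClass := by
  rw [← degClass_comp_classEquiv f]
  constructor
  · intro h
    have h' : Function.Bijective ((T.data.realifiedF.degClass ∘ f.classEquiv) ∘ f.classEquiv.symm) :=
      h.comp f.classEquiv.symm.bijective
    convert h' using 1
    funext c
    simp only [Function.comp_apply, Equiv.apply_symm_apply]
  · intro h
    exact h.comp f.classEquiv.bijective

/-- Every member of the connected component of a DEGREE-CLASSIFIED model strip is degree-classified (print: every
`*𝒞^⊩` is «isomorphic to the category `𝒞^⊩_mod`», [IUTchI] Def 5.2 (iv)(a) pp. 134–135).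
[cite: Mochizuki2012, Def 4.9 (viii) p.158] -/
theorem KitComponent.degClass_injective {M : FVdashSplitTriMuPrimeStrip.{u, v, w} P G X}
    (hM : Function.Injective M.data.realifiedF.degClass) (A : KitComponent M) :
    Function.Injective A.obj.data.realifiedF.degClass := by
  obtain ⟨e⟩ := A.property
  exact (degClass_injective_iff_of_hom e.hom).mpr hM

/-- Every member of the connected component of a model strip degree-classified ONTO `ℝ` is degree-classified onto `ℝ`.
[cite: Mochizuki2012, Def 4.9 (viii) p.158] -/
theorem KitComponent.degClass_bijective {M : FVdashSplitTriMuPrimeStrip.{u, v, w} P G X}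
    (hM : Function.Bijective M.data.realifiedF.degClass) (A : KitComponent M) :
    Function.Bijective A.obj.data.realifiedF.degClass := by
  obtain ⟨e⟩ := A.property
  exact (degClass_bijective_iff_of_hom e.hom).mpr hM

/-! ### §2 Faithfulness of «passing to the `F^{⊢▶×μ}`-prime-strip» on the component of a degree-classified model -/

/-- **IUTchII:Def4.9(viii)** (kurims p.158) / [IUTchII] Cor 4.6 (ii) p.138 «uniquely determined by … local isomorphisms»:
on the connected component of a DEGREE-CLASSIFIED model strip `M`, passing to the `F^{⊢▶×μ}`-prime-strip
(`(kitProperty M).ι ⋙ toSplitStripFunctor`) is FAITHFUL — a morphism of `F^{⊩▶×μ}`-prime-strips between members is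
determined by its local part; no «extra automorphisms» of the R9-F1 kind exist on the component.
[cite: Mochizuki2012, Cor 4.6 (ii) p.138] -/
theorem KitComponent.faithful_toSplitStrip {M : FVdashSplitTriMuPrimeStrip.{u, v, w} P G X}
    (hM : Function.Injective M.data.realifiedF.degClass) :
    ((kitProperty M).ι ⋙ toSplitStripFunctor).Faithful :=
  ⟨fun {_ B} _ _ h =>
    (kitProperty M).hom_ext (Hom.ext_of_locSplitIso_eq (KitComponent.degClass_injective hM B) h)⟩

/-- In particular `Aut_{F^{⊩▶×μ}}(A) → Aut_{F^{⊢▶×μ}}(A)` is INJECTIVE for every member `A` of the component of a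
degree-classified model (complementary to the surjectivity onto `F^{⊢×μ}` of [IUTchIII] Thm 2.2 (i) /
abc-iut-w4-d028's `mapAut_toTimesMu_surjective`). [cite: Mochizuki2012, Def 4.9 (viii) p.158] -/
theorem KitComponent.mapIso_toSplitStrip_injective {M : FVdashSplitTriMuPrimeStrip.{u, v, w} P G X}
    (hM : Function.Injective M.data.realifiedF.degClass) (A B : KitComponent M) :
    Function.Injective
      (((kitProperty M).ι ⋙ toSplitStripFunctor).mapIso : (A ≅ B) → _) := by
  haveI := KitComponent.faithful_toSplitStrip hM
  intro e e' h
  exact Iso.ext (((kitProperty M).ι ⋙ toSplitStripFunctor).map_injective (congrArg Iso.hom h))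

/-! ### §3 The hom-sets of the component of a model degree-classified onto `ℝ` -/

/-- **IUTchII:Def4.9(viii)** (kurims p.158) on the connected component of a model strip degree-classified ONTO `ℝ`,
`Hom(A, B)` IS the set of `V`-families of split local isomorphisms compatible with the valuations `ρ_v` and the
generators at bad places (`f ↦ (local part, compatibilities)` is a bijection). [cite: Mochizuki2012, Def 4.9 (viii) p.158] -/
theorem KitComponent.hom_bijective_local {M : FVdashSplitTriMuPrimeStrip.{u, v, w} P G X}
    (hM : Function.Bijective M.data.realifiedF.degClass) (A B : KitComponent M) :
    Function.Bijective fun f : A ⟶ B =>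
      (⟨f.hom.locSplitIso, f.hom.map_rho, f.hom.map_triGen⟩ :
        {e : ∀ v : V, LocalTriMuDatum.SplitIso (A.obj.data.strip.localDatum v) (B.obj.data.strip.localDatum v) //
          (∀ (v : V) (a : OTri (A.obj.data.strip.localDatum v).O),
              B.obj.data.rho v ((e v).eTri a) = A.obj.data.rho v a) ∧
          ∀ (v : V) (h : P.kind v = PlaceKind.bad), (e v).eTri (A.obj.data.triGen v h) = B.obj.data.triGen v h}) := by
  have hbij := locSplitIso_bijective (KitComponent.degClass_bijective hM A) (KitComponent.degClass_bijective hM B)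
  exact hbij.comp ⟨fun f g h => (kitProperty M).hom_ext h, fun g => ⟨ObjectProperty.homMk g, rfl⟩⟩

/-- **IUTchII:Cor4.6(ii)** (kurims p.138) «uniquely determined by … local isomorphisms»: on the connected component of a
DEGREE-CLASSIFIED model strip, two isomorphisms `A ≅ B` with the same local part coincide (an isomorphism always
exists there, `KitComponent.iso_nonempty`). [cite: Mochizuki2012, Cor 4.6 (ii) p.138] -/
theorem KitComponent.iso_unique_of_locSplitIso {M : FVdashSplitTriMuPrimeStrip.{u, v, w} P G X}
    (hM : Function.Injective M.data.realifiedF.degClass) {A B : KitComponent M} (e e' : A ≅ B)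
    (h : e.hom.hom.locSplitIso = e'.hom.hom.locSplitIso) : e = e' :=
  Iso.ext ((kitProperty M).hom_ext (Hom.ext_of_locSplitIso_eq (KitComponent.degClass_injective hM B) h))

/-- On the connected component of a degree-classified model strip, an automorphism of a member whose local part is the
identity IS the identity. [cite: Mochizuki2012, Def 4.9 (viii) p.158] -/
theorem KitComponent.eq_id_of_locSplitIso_eq_refl {M : FVdashSplitTriMuPrimeStrip.{u, v, w} P G X}
    (hM : Function.Injective M.data.realifiedF.degClass) {A : KitComponent M} (f : A ⟶ A)
    (h : ∀ v, f.hom.locSplitIso v = LocalTriMuDatum.SplitIso.refl _) : f = 𝟙 A :=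
  (kitProperty M).hom_ext (by
    rw [ObjectProperty.FullSubcategory.id_hom]
    exact FVdashSplitTriMuPrimeStrip.eq_id_of_locSplitIso_eq_refl (KitComponent.degClass_injective hM A) f.hom h)

end FVdashSplitTriMuPrimeStrip

end Literature.IUT.HodgeArakelov
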